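import Summits.Ventures.YMGap.Thresholds.MassGapAtMassive
import Summits.Ventures.YMGap.Thresholds.SharpImprovedThresholdFree
import HarnessLib

/-!
# Venture YMGap — EVERY DLR STATE OF `SU(N)` LATTICE YANG–MILLS ON `ℤ⁴` IS MASSIVE AT THE SHARP
# BAKRY–ÉMERY WINDOW `|β| < 1/32` ('t Hooft), EVERY `N ≥ 2` — hypothesis-free rows

HONEST FRAMING: venture file (cell `pub-ymgap`, seat ds-3), strong-coupling LATTICE rows for `SU(N)`
lattice Yang–Mills on `ℤ⁴` with the Wilson action ('t Hooft coupling `β`, tree coupling `N β`, Wilson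
`β_W = N² β`). WHAT THIS IS: the composition of two tree theorems — the OBJECT-U capstone
`SharpUniquenessJoin.massGapAt_dim4_free : 2 ≤ N → |β| < 1/32 → MassGapAt 4 N β` (hypothesis-free
sharp mass gap: DLR uniqueness + Shen–Zhu–Zhu clustering of Lipschitz cylinder functions) and the bridge
`MassGapMassive.isMassiveState_of_massGapAt` (DLR smoothing: `MassGapAt` ⇒ every DLR state is a massive
state of the barrier catalogue, `Literature.Barriers.QuantumFields.IsMassiveState`, with exponential decay
of the plaquette–plaquette correlation function). ROWS: for every `N ≥ 2` and every 't Hooft `|β| < 1/32`,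
every DLR state (and every infinite-volume limit state) of `SU(N)` lattice Yang–Mills on `ℤ⁴` is MASSIVE
and its `plaquetteCorrFn` decays exponentially; `SU(3)`: every Wilson `|β_W| < 9/32`. The previous
hypothesis-free window for these two currencies was the vertex-star door `|β| ≤ 9/308`
(`StarSUNMassive.isMassiveState_dlr_SU_star`); `1/32 = (77/72)·(9/308)`; printed strong-coupling bar
`1/48` (Shen–Zhu–Zhu). `SU(2)` keeps its wider two-sided window `|β| ≤ 9/100` (`SignFlip`). WHAT IT IS
NOT: no rate beyond `∃ m > 0`; `d = 4`; lattice strong coupling only; nothing about the continuum,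
confinement at weak coupling, a transfer-matrix gap or the Clay problem.

References: H. Shen, R. Zhu, X. Zhu, CMP 400 (2023) 805–851, Thm. 1.2, Cor. 1.4, Rem. 1.3;
K. Osterwalder, E. Seiler, Ann. Phys. 110 (1978) 440, §4; S. Chatterjee, arXiv:1803.01950, §4.
-/

noncomputable section

open MeasureTheory ProbabilityTheory
open Literature.MathematicalPhysics.QuantumLattice (fundamentalRep ymGibbsMeasures infiniteVolumeLimitPoints
  plaquetteCorrFn)
open Literature.Probability.LatticeModels (HasExponentialDecay)
open Literature.Barriers.QuantumFields (IsMassiveState)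

namespace Summit.Ventures.YMGap.MassGapMassive

variable {N : ℕ}

/-- ★ **EVERY DLR STATE OF `SU(N)` LATTICE YANG–MILLS ON `ℤ⁴` IS MASSIVE at every 't Hooft `|β| < 1/32`,
EVERY `N ≥ 2`, HYPOTHESIS-FREE** (exponential clustering, at one rate, of all truncated correlations of
bounded measurable local observables): the sharp mass gap `massGapAt_dim4_free` through the DLR-smoothing
bridge `isMassiveState_of_massGapAt`. -/
theorem isMassiveState_sharp_free (hN : 2 ≤ N) {β : ℝ} (hβ : |β| < 1 / 32) :
    ∀ μ ∈ ymGibbsMeasures (d := 4) (fundamentalRep (Fin N)) ((N : ℝ) * β), IsMassiveState μ :=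
  isMassiveState_of_massGapAt (by omega) (SharpUniquenessJoin.massGapAt_dim4_free hN hβ)

/-- ★ **Exponential decay of the plaquette–plaquette correlation function of EVERY DLR STATE** of `SU(N)`
lattice Yang–Mills on `ℤ⁴`, every `N ≥ 2`, at every 't Hooft `|β| < 1/32` (hypothesis-free). -/
theorem hasExponentialDecay_plaquetteCorrFn_sharp_free (hN : 2 ≤ N) {β : ℝ} (hβ : |β| < 1 / 32) :
    ∀ μ ∈ ymGibbsMeasures (d := 4) (fundamentalRep (Fin N)) ((N : ℝ) * β),
      HasExponentialDecay (plaquetteCorrFn (fundamentalRep (Fin N)) μ) :=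
  hasExponentialDecay_plaquetteCorrFn_of_massGapAt (by omega) (SharpUniquenessJoin.massGapAt_dim4_free hN hβ)

/-- **Limit states**: every infinite-volume limit point of the torus Wilson states of `SU(N)` lattice
Yang–Mills on `ℤ⁴` (`N ≥ 2`) at 't Hooft `|β| < 1/32` is massive. -/
theorem isMassiveState_limit_sharp_free (hN : 2 ≤ N) {β : ℝ} (hβ : |β| < 1 / 32) :
    ∀ μ ∈ infiniteVolumeLimitPoints (d := 4) (fundamentalRep (Fin N)) ((N : ℝ) * β), IsMassiveState μ :=
  isMassiveState_limit_of_massGapAt (by omega) (SharpUniquenessJoin.massGapAt_dim4_free hN hβ)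

/-- **Tree-coupling form** (the currency of ds-1's `StarSUN` rows): at every tree coupling `b` with
`|b|/N < 1/32`, every DLR state of `ymSpecification (fundamentalRep (Fin N)) b` on `ℤ⁴` is massive. -/
theorem isMassiveState_sharp_free_tree (hN : 2 ≤ N) {b : ℝ} (hb : |b| / N < 1 / 32) :
    ∀ μ ∈ ymGibbsMeasures (d := 4) (fundamentalRep (Fin N)) b, IsMassiveState μ := by
  have hN0 : (0 : ℝ) < N := by exact_mod_cast (show 0 < N by omega)
  have hβ : |b / N| < 1 / 32 := by rwa [abs_div, abs_of_pos hN0]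
  have hb' : ((N : ℝ) * (b / N)) = b := mul_div_cancel₀ b hN0.ne'
  rw [← hb']
  exact isMassiveState_sharp_free hN hβ

/-- **Tree-coupling form, plaquette decay.** -/
theorem hasExponentialDecay_plaquetteCorrFn_sharp_free_tree (hN : 2 ≤ N) {b : ℝ} (hb : |b| / N < 1 / 32) :
    ∀ μ ∈ ymGibbsMeasures (d := 4) (fundamentalRep (Fin N)) b,
      HasExponentialDecay (plaquetteCorrFn (fundamentalRep (Fin N)) μ) := by
  have hN0 : (0 : ℝ) < N := by exact_mod_cast (show 0 < N by omega)
  have hβ : |b / N| < 1 / 32 := by rwa [abs_div, abs_of_pos hN0]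
  have hb' : ((N : ℝ) * (b / N)) = b := mul_div_cancel₀ b hN0.ne'
  rw [← hb']
  exact hasExponentialDecay_plaquetteCorrFn_sharp_free hN hβ

/-- ★ **`SU(3)`: every DLR state of `SU(3)` lattice Yang–Mills on `ℤ⁴` is MASSIVE at every Wilson
`|β_W| < 9/32 = 0.28125`** (tree coupling `β_W/3`; hypothesis-free; previous hypothesis-free window
`|β_W| ≤ 81/308 = 0.26299`, printed bar `3/16`). -/
theorem su3_isMassiveState_dlr_sharp_free {βW : ℝ} (h : |βW| < 9 / 32) :
    ∀ μ ∈ ymGibbsMeasures (d := 4) (fundamentalRep (Fin 3)) (βW / 3), IsMassiveState μ := by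
  have hβ : |βW / 9| < 1 / 32 := by
    rw [abs_div, abs_of_pos (by norm_num : (0 : ℝ) < 9)]
    linarith [h]
  rw [show βW / 3 = ((3 : ℕ) : ℝ) * (βW / 9) by push_cast; ring]
  exact isMassiveState_sharp_free (N := 3) (by norm_num) hβ

/-- ★ **`SU(3)`: plaquette–plaquette decay of every DLR state at every Wilson `|β_W| < 9/32`.** -/
theorem su3_hasExponentialDecay_plaquetteCorrFn_dlr_sharp_free {βW : ℝ} (h : |βW| < 9 / 32) :
    ∀ μ ∈ ymGibbsMeasures (d := 4) (fundamentalRep (Fin 3)) (βW / 3),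
      HasExponentialDecay (plaquetteCorrFn (fundamentalRep (Fin 3)) μ) := by
  have hβ : |βW / 9| < 1 / 32 := by
    rw [abs_div, abs_of_pos (by norm_num : (0 : ℝ) < 9)]
    linarith [h]
  rw [show βW / 3 = ((3 : ℕ) : ℝ) * (βW / 9) by push_cast; ring]
  exact hasExponentialDecay_plaquetteCorrFn_sharp_free (N := 3) (by norm_num) hβ

/-- The numbers: `9/308 < 1/32` (the sharp window strictly contains the star door, ratio `77/72`),
`1/48 < 1/32` (printed bar), and `SU(3)` Wilson `81/308 < 9/32`, `9/32 = 9·(1/32)`. -/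
theorem sharp_massive_numbers :
    (9 : ℝ) / 308 < 1 / 32 ∧ (1 : ℝ) / 32 = 77 / 72 * (9 / 308) ∧ (1 : ℝ) / 48 < 1 / 32 ∧
      (81 : ℝ) / 308 < 9 / 32 ∧ (9 : ℝ) / 32 = 9 * (1 / 32) := by
  norm_num

end Summit.Ventures.YMGap.MassGapMassive

end
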